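import Summits.Ventures.QEC.Thresholds.PlanarSurfaceCodePhenomSAWThresholds
import Summits.Ventures.QEC.Thresholds.PhenomenologicalBoxThresholds
import Literature.InformationTheory.QuantumCodes.PlanarCodeSpaceTimePathsTwoRate
import HarnessLib

/-!
# Planar surface codes with noisy measurement: the TWO-RATE threshold BOX `p, q < p₀(4.7476)` (`> .0112`) for every
# minimum-weight / space-time-MWPM decoder family, both records — unconditional, tier CERTIFIED (kernel)

Venture QEC, `Summits/Ventures/QEC/Thresholds/` (LADDER-QEC rung Q5, PARTITION row 09 "phenomenological"; qec-type-09 gen 6,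
cell item 135 «09.PSAW», part (C′)). `PlanarSurfaceCodePhenomSAWThresholds.lean` certifies the DIAGONAL `q = p` of the planar
memory experiment at the space-time SAW value `p₀(4.7476) > .0112`. Dennis–Kitaev–Landahl–Preskill's statement is a BOX in
the two rates (qubit faults `p`, measurement faults `q`); the Literature file `PlanarCodeSpaceTimePathsTwoRate.lean` carries
the space-time counting bound to two rates `p, q ≤ ρ ≤ 1/2` through the tree's inhomogeneous Peierls bound, and this file
packages it in the cell's two-rate vocabulary (`BelowThreshold₂`, `IsThresholdBoxLowerBound` of `TwoRateThreshold.lean`;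
census families `zPhenomFailureFamily₂` / `xPhenomFailureFamily₂`):

| theorem | statement | tier |
|---|---|---|
| `planar_phenom_belowThreshold₂_of_sawCountBound3` | `cₙ(ℤ³) ≤ C νⁿ`, `p, q ≤ ρ ≤ 1/2`, `4ν²ρ(1-ρ) < 1`, poly rounds ⇒ `P_fail(k; p, q) → 0` | CERTIFIED (kernel), parametric |
| `exists_gt_four_mul_sq_lt_one_of_lt_thresholdValue` | GENERIC: `ρ < p₀(μ')` (`μ' ≥ 1`) ⇒ some `ν > μ'` still has `4ν²ρ(1-ρ) < 1` | — |
| `planar_phenom_isThresholdBoxLowerBound_of_connectiveConstant_three_le` | `μ(ℤ³) ≤ μ' ⇒` the box `[0, p₀(μ'))²` is below threshold, every poly-bounded schedule and minimum-weight space-time decoder family of the `H_X` record | CERTIFIED (kernel), parametric |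
| ★ `planar_phenom_isThresholdBoxLowerBound_kernelZ3SymmK12`, `planar_phenom_isThresholdBoxLowerBound_0112`, `planar_phenom_mwpm_isThresholdBoxLowerBound_kernelZ3SymmK12` | **the box `p, q < p₀(4.7476)` (⊇ `[0, .0112)²`)** for the `H_X` record, every minimum-weight / space-time boundary-MWPM family; census form `planar_zPhenomFailureFamily₂_isThresholdBoxLowerBound` | CERTIFIED (kernel), unconditional |
| `planar_phenom_isThresholdBoxLowerBound'_kernelZ3SymmK12`, `planar_xPhenomFailureFamily₂_isThresholdBoxLowerBound` | SECOND RECORD (`H_Z` checks) by the space-time self-duality pull-back (`planar_xPhenomFailureProb_eq_pullback`, valid at every `(p, q)`) | CERTIFIED (kernel), unconditional |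
| ★ `planar_dklp_bothRecords_belowThreshold₂_0112` | for ALL `0 ≤ p, q < .0112` BOTH records of the planar memory experiment (any pair of minimum-weight space-time decoder families, poly rounds) have failure probability `→ 0` — the certified planar form of DKLP's "p, q < .0114" | CERTIFIED (kernel), unconditional |

HONEST FRAMING: certified LOWER bounds; decimals from the kernel certificate `μ(ℤ³) ≤ 4.7476`; one error type per record
(sector-wise decoding); DKLP's printed `.0114` (numerical `μ₃`) is a CLAIM, not asserted. No `native_decide`, no named fact.

## References

* [DennisEtAl2002] E. Dennis, A. Kitaev, A. Landahl, J. Preskill, *Topological quantum memory*, J. Math. Phys. 43 (2002)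
  4452–4505, arXiv:quant-ph/0110143, §4.2 ("Errors on horizontal links occur with probability p, and errors on vertical
  links occur with probability q"), §5.3 eqs. (threshold_iso), (threshold_iso_num) (the box `p, q < .0114`).
* [PonitzTittmann2000] A. Pönitz, P. Tittmann, Electron. J. Combin. 7 (2000) R21, Table 2 (`d = 3, k = 12`: `4.7476`).
* [LinPryadko2024] H.-K. Lin, L. P. Pryadko, Phys. Rev. A 109 (2024) 022407, §4.2 Thm 6 (permutation-equivalent codes).
-/

noncomputable section

namespace Summit.Ventures.QEC.Thresholds

open Filter Topology Finset Matrix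
open Literature.InformationTheory.QuantumCodes
open Literature.InformationTheory.QuantumCodes.PlanarCode
open Literature.InformationTheory.QuantumCodes.ToricCode (SAWCountBound3 IsPolyBounded)
open Literature.Probability.RandomPlanarGeometry

/-! ### The two-rate bound below `4ν² ρ(1-ρ) < 1` -/

/-- The rates of the two-rate model are `≤ 1` when `p, q ≤ ρ ≤ 1/2` (for non-negativity of the weights).
[cite: DennisEtAl2002, §4.2 (rates p, q)] -/
private theorem phenomRate_bounds {k T : ℕ} {p q ρ : ℝ} (hp0 : 0 ≤ p) (hq0 : 0 ≤ q) (hpρ : p ≤ ρ) (hqρ : q ≤ ρ)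
    (hρ : ρ ≤ 1 / 2) (ℓ : HistoryLoc (PlanarQubit k) (PlanarCheck k) T) :
    0 ≤ phenomRate p q ℓ ∧ phenomRate p q ℓ ≤ 1 := by
  rcases ℓ with ℓ | ℓ <;> simp [phenomRate] <;> constructor <;> linarith

open Classical in
/-- The two-rate failure probability of the memory experiment is at most the two-rate probability of an odd-crossing residual.
[cite: DennisEtAl2002, §5.2 (Prob_fail ≤ the probability of a non-trivial (relative) space-time polygon)] -/
theorem planar_phenom_failure₂_le_sum_oddResidual (k T : ℕ) {D : CSSPhenom.STDecoder (PlanarCheck k) (PlanarQubit k) T}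
    (hD : D.IsMinWeight (CSSPhenom.stSyn (planarHX k) T) (CSSPhenom.stCycles (planarHX k) T) hammingNorm)
    {p q ρ : ℝ} (hp0 : 0 ≤ p) (hq0 : 0 ≤ q) (hpρ : p ≤ ρ) (hqρ : q ≤ ρ) (hρ : ρ ≤ 1 / 2) :
    CSSPhenom.phenomFailureProb (planarHX k) T (planarSZ k : Set (PlanarQubit k → ZMod 2)) D p q ≤
      ∑ E ∈ univ.filter (fun E : CSSPhenom.History (PlanarCheck k) (PlanarQubit k) T =>
        ∑ b : Fin (k + 2), CSSPhenom.proj (D (CSSPhenom.stSyn (planarHX k) T E) + E) (Sum.inl (0, b)) = 1),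
        phenomenologicalWeight T p q (supp E) := by
  refine Finset.sum_le_sum_of_subset_of_nonneg (fun E hE => ?_) fun E _ _ => ?_
  · rw [Finset.mem_filter] at hE ⊢
    exact ⟨Finset.mem_univ _, planar_phenom_oddResidual_of_not_corrects k T hD hE.2⟩
  · exact indepWeight_nonneg (fun ℓ => (phenomRate_bounds hp0 hq0 hpρ hqρ hρ ℓ).1)
      (fun ℓ => (phenomRate_bounds hp0 hq0 hpρ hqρ hρ ℓ).2) _

/-- **Below threshold in the box `[0, ρ]²` when `4ν² ρ(1-ρ) < 1`** (given `cₙ(ℤ³) ≤ C νⁿ`, `ν > 0`, polynomially many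
rounds): for every minimum-weight space-time decoder family of the `H_X` record and every rate pair `0 ≤ p, q ≤ ρ ≤ 1/2`,
the two-rate failure probability of the planar memory experiment tends to `0`. [cite: DennisEtAl2002, §5.3 eq. (threshold_iso)] -/
theorem planar_phenom_belowThreshold₂_of_sawCountBound3 {C ν : ℝ} (hν : 0 < ν) (hC : SAWCountBound3 C ν) {T : ℕ → ℕ}
    (hT : IsPolyBounded T) (D : ∀ k, CSSPhenom.STDecoder (PlanarCheck k) (PlanarQubit k) (T k))
    (hD : ∀ k, (D k).IsMinWeight (CSSPhenom.stSyn (planarHX k) (T k)) (CSSPhenom.stCycles (planarHX k) (T k)) hammingNorm)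
    {p q ρ : ℝ} (hp0 : 0 ≤ p) (hq0 : 0 ≤ q) (hpρ : p ≤ ρ) (hqρ : q ≤ ρ) (hρ : ρ ≤ 1 / 2)
    (h4 : 4 * ν ^ 2 * (ρ * (1 - ρ)) < 1) :
    BelowThreshold₂ (fun k p q => CSSPhenom.phenomFailureProb (planarHX k) (T k)
      (planarSZ k : Set (PlanarQubit k → ZMod 2)) (D k) p q) p q := by
  have ht := st_tendsto_sum_oddResidual_twoRate hν hC hT D hD hp0 hq0 hpρ hqρ hρ h4
  refine squeeze_zero' (Filter.Eventually.of_forall fun k => ?_)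
    (Filter.Eventually.of_forall fun k => planar_phenom_failure₂_le_sum_oddResidual k (T k) (hD k) hp0 hq0 hpρ hqρ hρ) ht
  refine Finset.sum_nonneg fun E _ => ?_
  exact indepWeight_nonneg (fun ℓ => (phenomRate_bounds hp0 hq0 hpρ hqρ hρ ℓ).1)
    (fun ℓ => (phenomRate_bounds hp0 hq0 hpρ hqρ hρ ℓ).2) _

/-! ### From the connective constant to the box `[0, p₀(μ'))²` -/

/-- **GENERIC**: if `0 ≤ ρ < p₀(μ')` (`μ' ≥ 1`) then some `ν > μ'` still satisfies `4ν² ρ(1-ρ) < 1` (take `ν²` strictly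
between `μ'²` and `1/(4ρ(1-ρ))`). [cite: DennisEtAl2002, §5.3 eqs. (threshold_2d)–(p_c_2d)] -/
theorem exists_gt_four_mul_sq_lt_one_of_lt_thresholdValue {μ' ρ : ℝ} (hμ' : 1 ≤ μ') (hρ0 : 0 ≤ ρ)
    (hρ : ρ < thresholdValue μ') : ∃ ν : ℝ, μ' < ν ∧ 4 * ν ^ 2 * (ρ * (1 - ρ)) < 1 := by
  have hlt : ρ * (1 - ρ) < thresholdValue μ' * (1 - thresholdValue μ') :=
    mul_one_sub_lt_mul_one_sub hρ (by linarith [thresholdValue_le_half μ'])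
  have hμ'0 : 0 < μ' := lt_of_lt_of_le one_pos hμ'
  have h4 : 4 * μ' ^ 2 * (ρ * (1 - ρ)) < 1 := by
    calc 4 * μ' ^ 2 * (ρ * (1 - ρ)) < 4 * μ' ^ 2 * (thresholdValue μ' * (1 - thresholdValue μ')) := by gcongr
      _ = 1 := four_mul_sq_mul_thresholdValue hμ'
  set K : ℝ := 4 * (ρ * (1 - ρ)) with hK
  have hK0 : 0 ≤ K := by
    have : 0 ≤ 1 - ρ := by linarith [hρ.le.trans (thresholdValue_le_half μ')]
    positivity
  rcases hK0.eq_or_lt with hK00 | hKpos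
  · refine ⟨μ' + 1, by linarith, ?_⟩
    have : 4 * (μ' + 1) ^ 2 * (ρ * (1 - ρ)) = (μ' + 1) ^ 2 * K := by rw [hK]; ring
    rw [this, ← hK00, mul_zero]
    exact one_pos
  · have hlt' : μ' ^ 2 < 1 / K := by
      rw [lt_div_iff₀ hKpos]
      calc μ' ^ 2 * K = 4 * μ' ^ 2 * (ρ * (1 - ρ)) := by rw [hK]; ring
        _ < 1 := h4
    obtain ⟨t, ht1, ht2⟩ := exists_between hlt'
    have ht0 : 0 < t := lt_of_le_of_lt (sq_nonneg _) ht1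
    refine ⟨Real.sqrt t, ?_, ?_⟩
    · calc μ' = Real.sqrt (μ' ^ 2) := (Real.sqrt_sq hμ'0.le).symm
        _ < Real.sqrt t := Real.sqrt_lt_sqrt (sq_nonneg _) ht1
    · rw [Real.sq_sqrt ht0.le]
      calc 4 * t * (ρ * (1 - ρ)) = t * K := by rw [hK]; ring
        _ < 1 / K * K := by gcongr
        _ = 1 := by field_simp

/-- **Planar two-rate threshold box from any bound on `μ(ℤ³)`**: if `μ(ℤ³) ≤ μ'` (`μ' ≥ 1`), every rate pair in the box
`[0, p₀(μ'))²` is below threshold for every polynomially bounded schedule and every minimum-weight space-time decoder family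
of the `H_X` record. [cite: DennisEtAl2002, §5.3 eqs. (saw_3), (threshold_iso_num)] -/
theorem planar_phenom_isThresholdBoxLowerBound_of_connectiveConstant_three_le {μ' : ℝ} (hμ'1 : 1 ≤ μ')
    (hμ : SAW.Zd.connectiveConstant 3 ≤ μ') {T : ℕ → ℕ} (hT : IsPolyBounded T)
    (D : ∀ k, CSSPhenom.STDecoder (PlanarCheck k) (PlanarQubit k) (T k))
    (hD : ∀ k, (D k).IsMinWeight (CSSPhenom.stSyn (planarHX k) (T k)) (CSSPhenom.stCycles (planarHX k) (T k)) hammingNorm) :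
    IsThresholdBoxLowerBound (fun k p q => CSSPhenom.phenomFailureProb (planarHX k) (T k)
      (planarSZ k : Set (PlanarQubit k → ZMod 2)) (D k) p q) (thresholdValue μ') := by
  refine IsThresholdBoxLowerBound.of_forall_le fun p q ρ hp0 hq0 hpρ hqρ hρ => ?_
  have hρ0 : 0 ≤ ρ := hp0.trans hpρ
  have hρh : ρ ≤ 1 / 2 := hρ.le.trans (thresholdValue_le_half μ')
  obtain ⟨ν, hν, h4⟩ := exists_gt_four_mul_sq_lt_one_of_lt_thresholdValue hμ'1 hρ0 hρ
  obtain ⟨C, hC⟩ := exists_sawCountBound3_of_connectiveConstant_lt (lt_of_le_of_lt hμ hν)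
  exact planar_phenom_belowThreshold₂_of_sawCountBound3 (by linarith) hC hT D hD hp0 hq0 hpρ hqρ hρh h4

/-- ★ **The planar two-rate threshold BOX `p, q < p₀(4.7476)`** (`H_X` record, every polynomially bounded schedule, every
minimum-weight space-time decoder family) — UNCONDITIONAL, tier CERTIFIED (kernel), from `μ(ℤ³) ≤ 4.7476`.
[cite: DennisEtAl2002, §5.3 eq. (threshold_iso_num) (the box p, q)] [cite: PonitzTittmann2000, Table 2 (d = 3, k = 12)] -/
theorem planar_phenom_isThresholdBoxLowerBound_kernelZ3SymmK12 {T : ℕ → ℕ} (hT : IsPolyBounded T)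
    (D : ∀ k, CSSPhenom.STDecoder (PlanarCheck k) (PlanarQubit k) (T k))
    (hD : ∀ k, (D k).IsMinWeight (CSSPhenom.stSyn (planarHX k) (T k)) (CSSPhenom.stCycles (planarHX k) (T k)) hammingNorm) :
    IsThresholdBoxLowerBound (fun k p q => CSSPhenom.phenomFailureProb (planarHX k) (T k)
      (planarSZ k : Set (PlanarQubit k → ZMod 2)) (D k) p q) (thresholdValue 4.7476) :=
  planar_phenom_isThresholdBoxLowerBound_of_connectiveConstant_three_le (by norm_num)
    SAW.Zd.FiniteMemory3.connectiveConstant_three_le_47476 hT D hD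

/-- ★ Decimal box: **every rate pair `0 ≤ p, q < .0112` is below threshold** for the planar memory experiment (`H_X` record,
poly rounds, every minimum-weight space-time decoder family) — UNCONDITIONAL, tier CERTIFIED (kernel).
[cite: DennisEtAl2002, §5.3 eq. (threshold_iso_num)] -/
theorem planar_phenom_isThresholdBoxLowerBound_0112 {T : ℕ → ℕ} (hT : IsPolyBounded T)
    (D : ∀ k, CSSPhenom.STDecoder (PlanarCheck k) (PlanarQubit k) (T k))
    (hD : ∀ k, (D k).IsMinWeight (CSSPhenom.stSyn (planarHX k) (T k)) (CSSPhenom.stCycles (planarHX k) (T k)) hammingNorm) :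
    IsThresholdBoxLowerBound (fun k p q => CSSPhenom.phenomFailureProb (planarHX k) (T k)
      (planarSZ k : Set (PlanarQubit k → ZMod 2)) (D k) p q) 0.0112 :=
  (planar_phenom_isThresholdBoxLowerBound_kernelZ3SymmK12 hT D hD).mono thresholdValue_47476_bounds.1.le

/-- Census form: the box for `zPhenomFailureFamily₂ (planarHGPCode ·)` (definitionally the same family).
[cite: DennisEtAl2002, §5.3 eq. (threshold_iso_num)] -/
theorem planar_zPhenomFailureFamily₂_isThresholdBoxLowerBound {T : ℕ → ℕ} (hT : IsPolyBounded T)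
    (D : ∀ k, CSSPhenom.STDecoder (PlanarCheck k) (PlanarQubit k) (T k))
    (hD : ∀ k, (D k).IsMinWeight (CSSPhenom.stSyn (planarHX k) (T k)) (CSSPhenom.stCycles (planarHX k) (T k)) hammingNorm) :
    IsThresholdBoxLowerBound (zPhenomFailureFamily₂ (fun k => planarHGPCode k) T D) (thresholdValue 4.7476) :=
  planar_phenom_isThresholdBoxLowerBound_kernelZ3SymmK12 hT D hD

/-- **Space-time boundary-MWPM**: the same box for every space-time boundary-MWPM family of the `H_X` record.
[cite: DennisEtAl2002, §5.1 (E_min by matching) and §5.3 eq. (threshold_iso_num)] -/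
theorem planar_phenom_mwpm_isThresholdBoxLowerBound_kernelZ3SymmK12 {T : ℕ → ℕ} (hT : IsPolyBounded T)
    {ι : ∀ k, PlanarQubit k → Sym2 (Option (PlanarCheck k))} (hι : ∀ k, IsGraphlikeVia (planarHX k) (ι k))
    (m : ∀ k, EdgeMetric (stEndsOf (ι k) (T k)))
    {D' : ∀ k, Decoder (Option (PlanarCheck k × Fin (T k + 1)) → ZMod 2)
      (HistoryLoc (PlanarQubit k) (PlanarCheck k) (T k) → ZMod 2)}
    (hD : ∀ k, IsMatchingDecoder (m k) (D' k)) :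
    IsThresholdBoxLowerBound (fun k p q => CSSPhenom.phenomFailureProb (planarHX k) (T k)
      (planarSZ k : Set (PlanarQubit k → ZMod 2)) (boundaryDecoder (D' k)) p q) (thresholdValue 4.7476) :=
  planar_phenom_isThresholdBoxLowerBound_kernelZ3SymmK12 hT _ fun k => isMinWeight_boundaryDecoder_st (hι k) (T k) (hD k)

/-! ### The second record by the space-time self-duality; both records -/

/-- **Second record (`H_Z` checks): the box `p, q < p₀(4.7476)`** for every polynomially bounded schedule and every
minimum-weight space-time decoder family — the `H_Z`-record two-rate failure probability of `D'` IS the `H_X`-record one of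
its space-time pull-back (`planar_xPhenomFailureProb_eq_pullback`, at every `(p, q)`). UNCONDITIONAL, tier CERTIFIED (kernel).
[cite: DennisEtAl2002, §4.1 and §5.3 eq. (threshold_iso_num)] [cite: LinPryadko2024, §4.2 Thm 6] -/
theorem planar_phenom_isThresholdBoxLowerBound'_kernelZ3SymmK12 {T : ℕ → ℕ} (hT : IsPolyBounded T)
    (D' : ∀ k, CSSPhenom.STDecoder (PlanarZCheck k) (PlanarQubit k) (T k))
    (hD' : ∀ k, (D' k).IsMinWeight (CSSPhenom.stSyn (planarHZ k) (T k)) (CSSPhenom.stCycles (planarHZ k) (T k))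
      hammingNorm) :
    IsThresholdBoxLowerBound (fun k p q => CSSPhenom.phenomFailureProb (planarHZ k) (T k)
      (planarSX k : Set (PlanarQubit k → ZMod 2)) (D' k) p q) (thresholdValue 4.7476) := by
  have hfam : (fun k p q => CSSPhenom.phenomFailureProb (planarHZ k) (T k)
      (planarSX k : Set (PlanarQubit k → ZMod 2)) (D' k) p q) = fun k p q =>
        CSSPhenom.phenomFailureProb (planarHX k) (T k) (planarSZ k : Set (PlanarQubit k → ZMod 2))
          (planarSTPullback k (T k) (D' k)) p q := by
    funext k p q
    exact planar_xPhenomFailureProb_eq_pullback k (T k) (D' k) p q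
  rw [hfam]
  exact planar_phenom_isThresholdBoxLowerBound_kernelZ3SymmK12 hT _ fun k => planarSTPullback_isMinWeight k (T k) (hD' k)

/-- Census form, second record: the box for `xPhenomFailureFamily₂ (planarHGPCode ·)`.
[cite: DennisEtAl2002, §5.3 eq. (threshold_iso_num)] -/
theorem planar_xPhenomFailureFamily₂_isThresholdBoxLowerBound {T : ℕ → ℕ} (hT : IsPolyBounded T)
    (D' : ∀ k, CSSPhenom.STDecoder (PlanarZCheck k) (PlanarQubit k) (T k))
    (hD' : ∀ k, (D' k).IsMinWeight (CSSPhenom.stSyn (planarHZ k) (T k)) (CSSPhenom.stCycles (planarHZ k) (T k))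
      hammingNorm) :
    IsThresholdBoxLowerBound (xPhenomFailureFamily₂ (fun k => planarHGPCode k) T D') (thresholdValue 4.7476) :=
  planar_phenom_isThresholdBoxLowerBound'_kernelZ3SymmK12 hT D' hD'

/-- ★ **DKLP's box for the complete planar memory experiment, certified at `.0112`**: for ALL `0 ≤ p, q < .0112`, every
polynomially bounded schedule of rounds and every pair of minimum-weight space-time decoder families (one per record), BOTH
records of the planar surface codes have failure probability `→ 0` (the printed toric figure is "p, q < .0114", numerical).
UNCONDITIONAL, tier CERTIFIED (kernel). [cite: DennisEtAl2002, §5.3 eq. (threshold_iso_num) and §4.1 (both error types)] -/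
theorem planar_dklp_bothRecords_belowThreshold₂_0112 {T : ℕ → ℕ} (hT : IsPolyBounded T)
    (DZ : ∀ k, CSSPhenom.STDecoder (PlanarCheck k) (PlanarQubit k) (T k))
    (hDZ : ∀ k, (DZ k).IsMinWeight (CSSPhenom.stSyn (planarHX k) (T k)) (CSSPhenom.stCycles (planarHX k) (T k))
      hammingNorm)
    (DX : ∀ k, CSSPhenom.STDecoder (PlanarZCheck k) (PlanarQubit k) (T k))
    (hDX : ∀ k, (DX k).IsMinWeight (CSSPhenom.stSyn (planarHZ k) (T k)) (CSSPhenom.stCycles (planarHZ k) (T k))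
      hammingNorm)
    {p q : ℝ} (hp₀ : 0 ≤ p) (hq₀ : 0 ≤ q) (hp : p < 0.0112) (hq : q < 0.0112) :
    BelowThreshold₂ (fun k p q => CSSPhenom.phenomFailureProb (planarHX k) (T k)
        (planarSZ k : Set (PlanarQubit k → ZMod 2)) (DZ k) p q) p q ∧
      BelowThreshold₂ (fun k p q => CSSPhenom.phenomFailureProb (planarHZ k) (T k)
        (planarSX k : Set (PlanarQubit k → ZMod 2)) (DX k) p q) p q :=
  ⟨(planar_phenom_isThresholdBoxLowerBound_kernelZ3SymmK12 hT DZ hDZ).mono thresholdValue_47476_bounds.1.le p q hp₀ hq₀ hp hq,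
    (planar_phenom_isThresholdBoxLowerBound'_kernelZ3SymmK12 hT DX hDX).mono thresholdValue_47476_bounds.1.le
      p q hp₀ hq₀ hp hq⟩

end Summit.Ventures.QEC.Thresholds
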